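import Mathlib
import HarnessLib
import Summits.Ventures.LatticeQCDFlow.Exactness.SUNResidualLayerJacobian
import Summits.Ventures.LatticeQCDFlow.Exactness.SUNResidualCouplingLayer

/-!
# The engine's general `SU(N)` residual coupling layer (stout-defect / plaquette-potential exponents with polynomial trace weights) is exact for product Haar, every `N`

HONEST FRAMING: exact (Metropolis-corrected) sampling algorithms for lattice gauge theory;
figures of merit are autocorrelation/cost numbers at stated couplings and volumes; no
continuum-physics claim.

Venture `LatticeQCDFlow` (cell pub-lqcd), topic `Exactness`; FANOUT row 10 (`eng-equiv`; engine
`equiv/residual.py` — `ResidualCoupling` with the exponent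
`Q(u) = Σ_j (Σ_{k<K} a_{jk}(y) (Re tr(u C_j(y))/n)^k) · (−𝒫(u C_j(y)))` over loop shapes `j` with
unitary staples `C_j(y)` and polynomial trace weights read from the frozen links `y`: stout,
stout-defect and plaquette-potential layers — `SUNResidualCouplingLayer.lean` typed its bijectivity /
homeomorphism / measurable automorphism under the certificate `Σ_j Σ_k (1+k)|a_{jk}| < 1`).  NEW
WORK of the cell: its EXACTNESS for product Haar on any link lattice `GaugeConfig d L SU(n)`, as the
instance of `SUNResidualLayerJacobian.hasJacobian_sunResidualLayer` — the ambient `C²` realisation of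
the exponent is the same formula with the staples and coefficients replaced by `C²` ambient
realisations (`Camb a j (coe U) = C a j (U|frozen)`, `aamb a j k (coe U) = a_{jk}(U|frozen)`; for the
engine's loop-product staples and constant / conditioner coefficients these are polynomials /
smooth maps of the link entries).  No definition is introduced.

* `contDiff_engineResidualExponentAmb` — the ambient exponent is `C²`;
* **`hasJacobian_engineResidualCouplingLayer`** — `∃ J` continuous, `> 0`:
  `HasJacobian (⊗_e Haar_{SU(n)}) (engine residual coupling layer) (ofReal ∘ J)`, every `n`, `d`,
  `L ≥ 1`, every mask, every finite family of loop shapes, every `K`.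

Printed counterparts, NAMED ONLY: Abbott et al., arXiv:2305.02402 §4.2; Morningstar–Peardon, PRD 69
(2004) 054501; M. Lüscher, CMP 293 (2010) 899, §3.
-/

noncomputable section

namespace Summit.Ventures.LatticeQCDFlow.Exactness

open Literature.MathematicalPhysics.QuantumFieldTheory
open Literature.MathematicalPhysics.QuantumFieldTheory.Luscher2010
open Literature.MathematicalPhysics.QuantumFieldTheory.WilsonFlow
open MeasureTheory Filter Set
open scoped Matrix Matrix.Norms.Frobenius Topology ContDiff ENNReal

variable {d L n : ℕ} [NeZero L] {σ : Type*} [Fintype σ]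

/-- **The ambient engine exponent is `C²`**: for `C²` ambient staples `Camb j` and coefficients
`aamb j k`, `W ↦ Σ_j (Σ_{k<K} aamb j k W · (Re tr(W a · Camb j W)/n)^k) · (−𝒫(W a · Camb j W))` is `C²`. -/
theorem contDiff_engineResidualExponentAmb (K : ℕ) (a : Edge d L)
    (Camb : σ → AmbConfig d L n → Matrix (Fin n) (Fin n) ℂ) (hC : ∀ j, ContDiff ℝ 2 (Camb j))
    (aamb : σ → ℕ → AmbConfig d L n → ℝ) (ha : ∀ j k, ContDiff ℝ 2 (aamb j k)) :
    ContDiff ℝ 2 fun W : AmbConfig d L n =>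
      ∑ j, ((∑ k ∈ Finset.range K, aamb j k W * (((W a * Camb j W).trace.re / n) ^ k) : ℝ) : ℂ) •
        (-suProj (W a * Camb j W)) := by
  refine ContDiff.sum fun j _ => ?_
  have hloop : ContDiff ℝ 2 fun W : AmbConfig d L n => W a * Camb j W := (contDiff_eval a).mul (hC j)
  have htr : ContDiff ℝ 2 fun W : AmbConfig d L n => ((W a * Camb j W).trace.re / n : ℝ) :=
    ((Complex.reCLM.contDiff.comp (contDiff_trace.comp hloop)).div_const _)
  have hpoly : ContDiff ℝ 2 fun W : AmbConfig d L n =>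
      ∑ k ∈ Finset.range K, aamb j k W * (((W a * Camb j W).trace.re / n) ^ k) :=
    ContDiff.sum fun k _ => (ha j k).mul (htr.pow k)
  exact (Complex.ofRealCLM.contDiff.comp hpoly).smul (contDiff_suProj.comp hloop).neg

/-- **The engine's general residual coupling layer is exact for product Haar, every `N`.**
Hypotheses: unitary staples `C a j y` and coefficients `acoef a j k y` reading the frozen links, the
certificate `Σ_j Σ_{k<K} (1+k)|acoef a j k y| < 1`, and `C²` ambient realisations `Camb`, `aamb` of
staples and coefficients.  Conclusion: a continuous positive `J` with
`HasJacobian (⊗_e Haar_{SU(n)}) (Theory2.coupleFun p ψ_engine) (ofReal ∘ J)`. -/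
theorem hasJacobian_engineResidualCouplingLayer (p : Edge d L → Prop) [DecidablePred p] (K : ℕ)
    (C : {e : Edge d L // p e} → σ → ({f : Edge d L // ¬p f} → Matrix.specialUnitaryGroup (Fin n) ℂ) →
      Matrix (Fin n) (Fin n) ℂ)
    (hCu : ∀ a j y, C a j y ∈ Matrix.unitaryGroup (Fin n) ℂ)
    (acoef : {e : Edge d L // p e} → σ → ℕ → ({f : Edge d L // ¬p f} → Matrix.specialUnitaryGroup (Fin n) ℂ) → ℝ)
    (hκ : ∀ a y, ∑ j, ∑ k ∈ Finset.range K, (1 + (k : ℝ)) * |acoef a j k y| < 1)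
    (Camb : {e : Edge d L // p e} → σ → AmbConfig d L n → Matrix (Fin n) (Fin n) ℂ)
    (hC2 : ∀ a j, ContDiff ℝ 2 (Camb a j))
    (hCamb : ∀ a j (U : GaugeConfig d L (Matrix.specialUnitaryGroup (Fin n) ℂ)),
      Camb a j (coeConfig U) = C a j (fun f => U f))
    (aamb : {e : Edge d L // p e} → σ → ℕ → AmbConfig d L n → ℝ) (ha2 : ∀ a j k, ContDiff ℝ 2 (aamb a j k))
    (haamb : ∀ a j k (U : GaugeConfig d L (Matrix.specialUnitaryGroup (Fin n) ℂ)),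
      aamb a j k (coeConfig U) = acoef a j k (fun f => U f)) :
    ∃ J : GaugeConfig d L (Matrix.specialUnitaryGroup (Fin n) ℂ) → ℝ,
      Continuous J ∧ (∀ U, 0 < J U) ∧
      HasJacobian (Measure.pi fun _ : Edge d L => haarProbability (Matrix.specialUnitaryGroup (Fin n) ℂ))
        (Theory2.coupleFun p fun a y (u : Matrix.specialUnitaryGroup (Fin n) ℂ) =>
          (⟨NormedSpace.exp (∑ j, ((∑ k ∈ Finset.range K, acoef a j k y *
                (((u : Matrix (Fin n) (Fin n) ℂ) * C a j y).trace.re / n) ^ k : ℝ) : ℂ) •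
              (-suProj ((u : Matrix (Fin n) (Fin n) ℂ) * C a j y))) * u,
            residual_value_mem (fun U _ => residualExponent_skew (fun j k => acoef a j k y) K
              (fun j => C a j y) U) u.2⟩ : Matrix.specialUnitaryGroup (Fin n) ℂ))
        (fun U => ENNReal.ofReal (J U)) :=
  hasJacobian_sunResidualLayer p
    (fun a y u => ∑ j, ((∑ k ∈ Finset.range K, acoef a j k y *
        ((u * C a j y).trace.re / n) ^ k : ℝ) : ℂ) • (-suProj (u * C a j y)))
    (fun a y => ∑ j, ∑ k ∈ Finset.range K, (1 + (k : ℝ)) * |acoef a j k y|)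
    (fun a W => ∑ j, ((∑ k ∈ Finset.range K, aamb a j k W *
        (((W a.1 * Camb a j W).trace.re / n) ^ k) : ℝ) : ℂ) • (-suProj (W a.1 * Camb a j W)))
    (fun a y U _ => residualExponent_skew (fun j k => acoef a j k y) K (fun j => C a j y) U)
    (fun a y _ hU _ hV => frobNorm_residualExponent_sub_le (fun j k => acoef a j k y) K (hCu a · y)
      (Matrix.mem_specialUnitaryGroup_iff.mp hU).1 (Matrix.mem_specialUnitaryGroup_iff.mp hV).1)
    (fun a y => contractionBound_nonneg (fun j k => acoef a j k y) K) hκ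
    (fun a => contDiff_engineResidualExponentAmb K a.1 (Camb a) (hC2 a) (aamb a) (ha2 a))
    (fun a U => by simp only [hCamb, haamb, coeConfig_apply])

end Summit.Ventures.LatticeQCDFlow.Exactness

end
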